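import Literature.AlgebraicGeometry.HodgeTheory.HodgeModelExistenceDischarge
import Literature.AlgebraicGeometry.Motives.HodgeDecompositionIsInternalDolbeaultProofs
import Literature.Geometry.Kaehler.TorusDolbeaultRegularityPq
import Literature.NumberTheory.Transcendental.DeRhamTheoremProofs
import HarnessLib

/-!
# Crux `WeilTwelvefoldsSqrtMinus7` (stmt-HodgeConjecture-1261), line `amnesic-secant-sheaves-split-fourteenfolds` — stub `stub_hodgeModelFacts`

The registered stub `stub_hodgeModelFacts` of the line's skeleton is the conjunction of two
Literature named facts consumed by the Künneth-for-Hodge-types stub `stub_hodgeTypeExterior`: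

* (a) `∀ m Y, Literature.AlgebraicGeometry.HodgeTheory.nonempty_hodgeModel m Y` — every smooth
  projective complex variety has a Hodge model (Serre, GAGA §2: analytification; de Rham's
  theorem; the Hodge decomposition of the compact Kähler manifold `X^an`, Voisin I Prop. 6.11);
* (b) `∀ E, Literature.NumberTheory.Transcendental.exists_deRhamIsoFamily 𝓘(ℝ, E)` —
  de Rham's theorem as a natural, MULTIPLICATIVE, normalised family (Warner Thm. 5.36/5.45).

This file PROVES (a) unconditionally (`nonempty_hodgeModel_all_holds`), by assembling theorems
already in the tree:

1. `hodgeDecomposition_holds` — the Hodge decomposition `H^k_dR(M; ℂ) = ⨁_{p+q=k} K^{p,q}` of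
   every compact Kähler manifold, i.e. the named fact
   `Literature.AlgebraicGeometry.Motives.isInternal_hodgePQ` (hodge.S07) for every model space
   and manifold: the tree's reduction `isInternal_hodgePQ_of_dolbeault_regularity_of_compactness`
   (Voisin's route Thm. 5.22 ⇒ 5.24 ⇒ 6.7 ⇒ Prop. 6.11,
   `HodgeDecompositionIsInternalDolbeaultProofs`) fed with Warner's Theorems 6.6 (compactness)
   and 6.5 (regularity) for `Δ_∂̄` on the smooth `(p,q)`-forms, PROVED in
   `Literature.Geometry.Kaehler.TorusDolbeaultCompactAll` / `…TorusDolbeaultRegularityPq`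
   (`CL2SmoothForms.pq_compact`, `CL2SmoothForms.pq_regular`);
2. de Rham's theorem with complex coefficients as a NATURAL family over the manifolds charted on
   `ℂⁿ`, PROVED as `Literature.NumberTheory.Transcendental.exists_complexDeRhamIsoFamily_holds`
   (integration over smooth simplices, complexified);
3. the assembly `nonempty_hodgeModel_of_complexDeRham_of_hodgeDecomposition`
   (`HodgeModelExistenceDischarge`: Serre's compact Hausdorff analytification, Kähler by the
   analytified closed immersion into `ℙᴺ(ℂ)`).

Conjunct (b) is NOT provable today: the integration family `integrationDeRhamIsoFamily` is
proved natural and normalised (`DeRhamTheoremProofs`), but its multiplicativity wedge ↦ cup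
(`DeRhamIsoFamily.IsMultiplicative`, Warner Thm. 5.45 / Bott–Tu Thm. 14.28) is proved nowhere in
the tree, and no theorem concludes `exists_deRhamIsoFamily`. Hence the stub is recorded here in
the FALLBACK form `stub_hodgeModelFacts_of_facts`: the registered conjunction from the single
named fact (b), taken verbatim in the shape the tree's consumers use
(`nonempty_hodgeModel_of_deRham_of_hodgeDecomposition`).

Not here: the discharges `isInternal_hodgePQ_holds` / `nonempty_hodgeModel_holds` under their
Literature names (they are the one-liners `hodgeDecomposition_holds` /
`nonempty_hodgeModel_all_holds m Y` of this file and belong in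
`Motives/HodgeDecompositionIsInternalDolbeaultProofs` / `HodgeTheory/HodgeModelExistenceDischarge`).

## References

* J.-P. Serre, *Géométrie algébrique et géométrie analytique*, Ann. Inst. Fourier 6 (1956),
  §2 n°5 Prop. 2, n°7 Prop. 6.
* C. Voisin, *Hodge Theory and Complex Algebraic Geometry I* (2002), §3.3.2, Thm. 5.22–5.24,
  Thm. 6.7, §6.1.3 Prop. 6.11.
* F. W. Warner, *Foundations of Differentiable Manifolds and Lie Groups*, GTM 94 (1983),
  Thms. 5.36, 5.45, 6.5, 6.6.
* R. O. Wells, *Differential Analysis on Complex Manifolds* (1980), Thm. III.4.13.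
-/

noncomputable section

-- single-problem summit (Problem = Summit): the mandated namespace repeats `HodgeConjecture`;
-- the lakefile turns the linter off tree-wide (weak option), restated for stand-alone elaboration.
set_option linter.dupNamespace false

open scoped Manifold ContDiff
open Bundle Module
open CategoryTheory Complex
open Literature.AlgebraicGeometry Literature.AlgebraicGeometry.Motives
  Literature.AlgebraicGeometry.HodgeTheory Literature.AlgebraicTopology.SingularHomology

namespace Summit.HodgeConjecture.HodgeConjecture.Theorems.WeilTwelvefoldsSqrtMinus7.AmnesicSecantSheaves

open Literature.Geometry.Kaehler Literature.NumberTheory.Transcendental in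
/-- **The Hodge decomposition of compact Kähler manifolds (hodge.S07), discharged.** For every
finite-dimensional complex model space `E` and every real-`C^∞` manifold `M` charted on `E`, the
named fact `isInternal_hodgePQ (E := E) (M := M)` holds: whenever `M` is moreover a compact
Hausdorff complex manifold admitting a Kähler metric, `H^k_dR(M; ℂ) = ⨁_{p+q=k} K^{p,q}` with
`K^{p,q}` the classes of closed `(p,q)`-forms (Voisin (2002), §6.1.3 Prop. 6.11). Proof: the
tree's reduction `isInternal_hodgePQ_of_dolbeault_regularity_of_compactness` (Voisin's route
through the elliptic theory of `Δ_∂̄`, Thm. 5.22 ⇒ Thm. 5.24, and the Kähler identity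
`Δ_d = 2Δ_∂̄`, Thm. 6.7) fed with Warner's Theorem 6.6 (`CL2SmoothForms.pq_compact`) and
Theorem 6.5 (`CL2SmoothForms.pq_regular`) for `Δ_∂̄` on the smooth `(p,q)`-forms of a compact
Hermitian manifold, both proved in `Literature.Geometry.Kaehler.TorusDolbeault*`.
[cite: VoisinHodgeI2002, §6.1.3 Prop. 6.11] -/
theorem hodgeDecomposition_holds {E : Type*} [NormedAddCommGroup E] [NormedSpace ℂ E]
    [FiniteDimensional ℂ E] {M : Type*} [TopologicalSpace M] [ChartedSpace E M]
    [IsManifold 𝓘(ℝ, E) ∞ M] : isInternal_hodgePQ (E := E) (M := M) := by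
  refine isInternal_hodgePQ_of_dolbeault_regularity_of_compactness (E := E) (M := M) ?_ ?_
  · -- Warner's Theorem 6.6 (compactness) for `Δ_∂̄` on `A^{p,q}(M)`
    intro _ _ _ _ _ n _ g hJ o p q m h ho
    letI : RiemannianBundle (fun x : M ↦ TangentSpace 𝓘(ℝ, E) x) :=
      ⟨g.toRiemannianMetric⟩
    haveI : IsContMDiffRiemannianBundle 𝓘(ℝ, E) ∞ E
        (fun x : M ↦ TangentSpace 𝓘(ℝ, E) x) :=
      ⟨g.inner, g.contMDiff, fun _ _ _ ↦ rfl⟩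
    haveI : Fact (IsSmoothForm (riemannianVolumeForm o)) := ⟨ho⟩
    exact fun u c hb hΔ ↦ CL2SmoothForms.pq_compact o hJ p q h u c hb hΔ
  · -- Warner's Theorem 6.5 (regularity of weak solutions) for `Δ_∂̄` on `A^{p,q}(M)`
    intro _ _ _ _ _ n _ g hJ o p q m h ho
    letI : RiemannianBundle (fun x : M ↦ TangentSpace 𝓘(ℝ, E) x) :=
      ⟨g.toRiemannianMetric⟩
    haveI : IsContMDiffRiemannianBundle 𝓘(ℝ, E) ∞ E
        (fun x : M ↦ TangentSpace 𝓘(ℝ, E) x) :=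
      ⟨g.inner, g.contMDiff, fun _ _ _ ↦ rfl⟩
    haveI : Fact (IsSmoothForm (riemannianVolumeForm o)) := ⟨ho⟩
    exact fun α ℓ hw ↦ CL2SmoothForms.pq_regular o hJ p q h α ℓ hw

/-- **Smooth projective complex varieties have Hodge models — conjunct (a) of the stub, proved.**
For every `m` and every `Y/ℂ`, the named fact `nonempty_hodgeModel m Y` holds: if `Y` is smooth
projective, geometrically irreducible of dimension `m`, then `Nonempty (HodgeModel m Y)`.
Assembly `nonempty_hodgeModel_of_complexDeRham_of_hodgeDecomposition` (Serre's analytification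
`Y^an → Y(ℂ)`, compact Hausdorff, Kähler through the analytified closed immersion
`Y^an ↪ ℙᴺ(ℂ)`) fed with (3) de Rham's theorem with complex coefficients, natural over the
manifolds charted on `ℂᵐ` (`exists_complexDeRhamIsoFamily_holds (Fin m → ℂ)`: integration
over smooth simplices, complexified) and (4b) the Hodge decomposition
`hodgeDecomposition_holds`.
[cite: SerreGAGA1956, §2 n°5 Prop. 2 and n°7 Prop. 6] [cite: WellsDACM1980, Thm. III.4.13]
[cite: VoisinHodgeI2002, §3.3.2 and §6.1.3 Prop. 6.11] -/
theorem nonempty_hodgeModel_all_holds :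
    ∀ (m : ℕ) (Y : SchemeOver ℂ), nonempty_hodgeModel m Y :=
  fun m _ ↦ nonempty_hodgeModel_of_complexDeRham_of_hodgeDecomposition
    (Literature.NumberTheory.Transcendental.exists_complexDeRhamIsoFamily_holds (Fin m → ℂ))
    (fun E _ _ _ M _ _ _ ↦ hodgeDecomposition_holds (E := E) (M := M))

/-- **The registered stub `stub_hodgeModelFacts` from its single unproved ingredient** (FALLBACK
form). Conjunct (a) "every smooth projective complex variety has a Hodge model" is the theorem
`nonempty_hodgeModel_all_holds`; conjunct (b), de Rham's theorem as a natural, multiplicative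
and normalised family `exists_deRhamIsoFamily 𝓘(ℝ, E)` for every finite-dimensional complex
model space (Warner (1983), Thm. 5.36 with Thm. 5.45: the integration family
`integrationDeRhamIsoFamily` is proved natural and normalised in the tree, its multiplicativity
wedge ↦ cup is not), is the hypothesis, taken verbatim as the tree's consumers do
(`nonempty_hodgeModel_of_deRham_of_hodgeDecomposition`).
[cite: WarnerGTM94, Thm. 5.36 / Thm. 5.45] -/
theorem stub_hodgeModelFacts_of_facts
    (h : ∀ (E : Type) [NormedAddCommGroup E] [NormedSpace ℂ E] [FiniteDimensional ℂ E],
      Literature.NumberTheory.Transcendental.exists_deRhamIsoFamily (modelWithCornersSelf ℝ E)) :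
    (∀ (m : ℕ) (Y : SchemeOver ℂ), nonempty_hodgeModel m Y) ∧
    (∀ (E : Type) [NormedAddCommGroup E] [NormedSpace ℂ E] [FiniteDimensional ℂ E],
      Literature.NumberTheory.Transcendental.exists_deRhamIsoFamily (modelWithCornersSelf ℝ E)) :=
  ⟨nonempty_hodgeModel_all_holds, h⟩

end Summit.HodgeConjecture.HodgeConjecture.Theorems.WeilTwelvefoldsSqrtMinus7.AmnesicSecantSheaves

end
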